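import Summits.FinalStateConjecture.FinalStateConjecture.Theses.ClusterCompleteness
import Literature.Geometry.Lorentzian.CoordCurvature
import Summits.FinalStateConjecture.FinalStateConjecture.Theorems.ClusterCompletenessOmegaLimitMultiKerrVacuumLimit
import Summits.FinalStateConjecture.FinalStateConjecture.Theorems.ClusterCompletenessOmegaLimitMultiKerrFluxTransfer
import Summits.FinalStateConjecture.FinalStateConjecture.Theorems.ClusterCompletenessOmegaLimitMultiKerrTranslates
import HarnessLib

/-!
# Route ClusterCompleteness · crux `OmegaLimitMultiKerr` (stmt-FinalStateConjecture-17639), line `Sketch` v7,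
# child 2 `TameEraRecurs`, stub 4 `stub_rebase` — the DARK LIMITS of an asymptotically stationary era are
# STATIONARY (invariant under the background's Killing translation)

Support file of the stub-worker audit of `stub_rebase` (wave 3, 2026-08-17; work file `work/stubs/stub_rebase.lean`
of the lead's folder; companion file `…RebaseDarkLimitCollar.lean`). The first third of the intended proof of
`stub_rebase` ("joint dark limits of the hole deviations exist by the all-time bounds, are stationary by
asymptotic stationarity, inherit the red-shift bound and the null boundary pointwise, hence are inputs of the
granted no-hair statement") needs, besides the landed existence / bounds / closeness / metricity / vacuum lemmas of
gens 3–6 (`…JointOmegaLimits`, `…LimitBounds`, `…OmegaLimitGlue`, `…LimitIsMetric`, `…VacuumOmegaLimits`), the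
transfer "asymptotically stationary in era gauge ⇒ every dark limit is stationary", which is the CONVERSE of the
landed bookkeeping `tendsto_supCkENorm_fderiv_translate_of_omegaLimits_stationary` (`…AsymptoticStationarity`) and
was not in the tree. In the toolkit's currency (translates `x ↦ h (x + Tₙ • e)` converging to `g` in `supCkENorm`
on compact subsets of the domain):

* `omegaLimit_translate_eq_self_of_tendsto_fderiv_apply` — abstract: if the translates of a `Cᵏ` field `h`
  (`k ≥ 1`) along `Tₙ` converge in `Cᵏ` on compacts of an open `e`-invariant set `O` to a `Cᵏ` field `g`, and
  `∂ₑ h (x + Tₙ • e) → 0` at every `x ∈ O`, then `g (x + s • e) = g x` on `O` (the derivative of the translate at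
  `x` is `∂ h (x + Tₙ • e)`, `fderiv_comp_add_right`; it converges to `∂ g (x)`,
  `tendsto_fderiv_of_tendsto_supCkENorm_sub`; so `∂ₑ g = 0`, and `translate_eq_self_of_fderiv_apply_eq_zero`).
* `tendsto_fderiv_deviationExtend_translate_of_asymptoticallyStationary` — the ERA CLAUSE of the v6/v7 skeleton
  verbatim (`supCkENorm` over the truncated slabs `{t* = τ, r ≤ R'}` of `y ↦ ∂_{Λe₀}(deviationExtend)(y)` tends to
  `0` as `τ → ∞` for every `R'`) gives `∂_{Λe₀}(deviation)(x + Tₙ Λe₀) → 0` along every `Tₙ → +∞`.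
* `hole_omegaLimit_translate_eq_self_of_asymptoticallyStationary` — hence every `Cᵏ` (`k ≥ 1`) dark limit `g` of
  the hole deviation is invariant under the Killing translation, and (registered sub-goal
  `hole_omegaLimit_chartMetric_translate_eq_self_of_asymptoticallyStationary`) so is the limit chart metric
  `g + g_{M,a,Λ,c}` — verbatim the stationarity hypothesis `G (x + s • Λe₀) = G x` of the no-hair statement
  granted to `stub_rebase`.

Everything is proved; Mathlib + landed `Literature` / `Theorems` files only; no definitions.
Hale 1980, Ch. I §8 and Ch. X §1 (ω-limit sets of translation flows lie in the largest invariant set).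
-/

set_option linter.dupNamespace false

noncomputable section

open scoped Manifold ContDiff Topology ENNReal
open Set Filter Function TopologicalSpace

namespace Summit.FinalStateConjecture.FinalStateConjecture.Theorems.ClusterCompleteness

open Literature.Geometry.Lorentzian

/-! ### Abstract: translates with vanishing `∂ₑ` have `e`-invariant ω-limits -/

section Abstract

variable {E : Type*} [NormedAddCommGroup E] [NormedSpace ℝ E] {W : Type*} [NormedAddCommGroup W]
  [NormedSpace ℝ W]

/-- **ω-limits of asymptotically `e`-stationary translates are `e`-invariant.** Let `O` be open and
invariant under `x ↦ x + s • e`, `h` and `g` of class `Cᵏ` on `O` (`k ≥ 1`), and let the translates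
`x ↦ h (x + Tₙ • e)` converge to `g` in `Cᵏ` on every compact subset of `O`. If the directional
derivative along the orbit vanishes asymptotically, `fderiv ℝ h (x + Tₙ • e) e → 0` for every `x ∈ O`,
then `g (x + s • e) = g x` for all `x ∈ O`, `s ∈ ℝ`. Hale 1980, Ch. I, §8 and Ch. X, §1 (the ω-limit
set lies in the largest invariant subset of `{V̇ = 0}`). [cite: Hale1980, Ch. X §1] -/
theorem omegaLimit_translate_eq_self_of_tendsto_fderiv_apply {O : Set E} (hO' : IsOpen O) {e : E}
    (hO : ∀ x ∈ O, ∀ s : ℝ, x + s • e ∈ O) {k : ℕ} (hk : 1 ≤ k) {h g : E → W}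
    (hh : ContDiffOn ℝ k h O) (hg : ContDiffOn ℝ k g O) {T : ℕ → ℝ}
    (hlim : ∀ K ⊆ O, IsCompact K →
      Tendsto (fun n ↦ supCkENorm K k (fun x ↦ h (x + T n • e) - g x)) atTop (𝓝 0))
    (hstat : ∀ x ∈ O, Tendsto (fun n ↦ fderiv ℝ h (x + T n • e) e) atTop (𝓝 0)) :
    ∀ x ∈ O, ∀ s : ℝ, g (x + s • e) = g x := by
  have hk' : (k : WithTop ℕ∞) ≠ 0 := by exact_mod_cast (by omega : k ≠ 0)
  have hgd : ∀ y ∈ O, DifferentiableAt ℝ g y := fun y hy ↦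
    ((hg y hy).contDiffAt (hO'.mem_nhds hy)).differentiableAt hk'
  refine translate_eq_self_of_fderiv_apply_eq_zero hO hgd fun y hy ↦ ?_
  -- the derivatives of the translates at `y` converge to the derivative of `g` at `y`
  have h1 : Tendsto (fun n ↦ fderiv ℝ (fun x ↦ h (x + T n • e)) y) atTop (𝓝 (fderiv ℝ g y)) := by
    refine tendsto_fderiv_of_tendsto_supCkENorm_sub hk (mem_singleton y)
      (Eventually.of_forall fun n ↦ ?_) ((hg y hy).contDiffAt (hO'.mem_nhds hy))
      (hlim {y} (singleton_subset_iff.2 hy) isCompact_singleton)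
    have hy' : y + T n • e ∈ O := hO y hy (T n)
    have hn : ContDiffAt ℝ k h (y + T n • e) := (hh _ hy').contDiffAt (hO'.mem_nhds hy')
    exact hn.comp y (contDiffAt_id.add contDiffAt_const)
  -- the derivative of the translate at `y` is the derivative of `h` at the translated point
  have h2 : ∀ n, fderiv ℝ (fun x ↦ h (x + T n • e)) y = fderiv ℝ h (y + T n • e) := fun n ↦
    fderiv_comp_add_right (T n • e)
  have h3 : Tendsto (fun n ↦ fderiv ℝ h (y + T n • e) e) atTop (𝓝 (fderiv ℝ g y e)) := by
    have h4 := ((ContinuousLinearMap.apply ℝ W e).continuous.tendsto _).comp h1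
    simp only [Function.comp_def, ContinuousLinearMap.apply_apply, h2] at h4
    exact h4
  exact tendsto_nhds_unique h3 (hstat y hy)

end Abstract

/-! ### Hole reading: the era's asymptotic-stationarity clause makes every dark limit stationary -/

section Hole

variable (𝓢 : Spacetime 4) (Λ : lorentzGroup) (c : E4) (M a : ℝ)

/-- Along the Killing orbit of a point `x` of the boosted exterior, the size of `∂_{Λe₀}` of the hole
deviation tends to `0` when the era's asymptotic-stationarity clause holds: the point `x + T n • Λe₀`
lies on the truncated slab of radius `r(x)` at chart time `t*(x) + T n → +∞`, whose `C⁰ ≤ Cᵐ` sup norm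
of `∂_{Λe₀}(deviation)` tends to `0`. [folklore] -/
theorem tendsto_fderiv_deviationExtend_translate_of_asymptoticallyStationary
    (Ψ : (boostedKerrBackground Λ c M a).domain → 𝓢.carrier) {m : ℕ}
    (hstat : ∀ R' : ℝ, Tendsto (fun τ ↦ supCkENorm
        (Subtype.val '' (boostedKerrBackground Λ c M a).truncTimeSlab R' τ) m
        (fun y ↦ fderiv ℝ (𝓢.deviationExtend (boostedKerrBackground Λ c M a) Ψ) y
          ((Λ : E4 ≃L[ℝ] E4) (E4.basisVector 0)))) atTop (𝓝 0))
    {T : ℕ → ℝ} (hT : Tendsto T atTop atTop) {x : E4}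
    (hx : x ∈ (boostedKerrExterior Λ c M a : Set E4)) :
    Tendsto (fun n ↦ fderiv ℝ (𝓢.deviationExtend (boostedKerrBackground Λ c M a) Ψ)
      (x + T n • (Λ : E4 ≃L[ℝ] E4) (E4.basisVector 0)) ((Λ : E4 ≃L[ℝ] E4) (E4.basisVector 0)))
      atTop (𝓝 0) := by
  -- the chart times of the translates tend to `+∞`
  have hτ : Tendsto (fun n ↦ (boostedKerrBackground Λ c M a).time x + T n) atTop atTop :=
    tendsto_atTop_add_const_left _ _ hT
  have h0 := (hstat ((boostedKerrBackground Λ c M a).radius x)).comp hτ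
  -- the translate of `x` lies on the truncated slab of radius `r(x)` at time `t*(x) + T n`
  have hmem : ∀ n, x + T n • (Λ : E4 ≃L[ℝ] E4) (E4.basisVector 0) ∈
      Subtype.val '' (boostedKerrBackground Λ c M a).truncTimeSlab
        ((boostedKerrBackground Λ c M a).radius x) ((boostedKerrBackground Λ c M a).time x + T n) := by
    intro n
    refine ⟨⟨x + T n • (Λ : E4 ≃L[ℝ] E4) (E4.basisVector 0),
      add_smul_mem_boostedKerrBackground_domain Λ c M a x hx (T n)⟩, ?_, rfl⟩
    rw [ModelBackground.mem_truncTimeSlab]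
    exact ⟨KerrSchildChart.time_add_smul Λ c M a x (T n),
      (KerrSchildChart.radius_add_smul Λ c M a x (T n)).le⟩
  -- squeeze the order-`0` jets (the toolkit's currency), then evaluate at the empty tuple
  have h1 : Tendsto (fun n ↦ iteratedFDeriv ℝ 0
      (fun y ↦ fderiv ℝ (𝓢.deviationExtend (boostedKerrBackground Λ c M a) Ψ) y
        ((Λ : E4 ≃L[ℝ] E4) (E4.basisVector 0)))
      (x + T n • (Λ : E4 ≃L[ℝ] E4) (E4.basisVector 0))) atTop (𝓝 0) :=
    tendsto_zero_iff_enorm_tendsto_zero.2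
      (tendsto_of_tendsto_of_tendsto_of_le_of_le tendsto_const_nhds h0 (fun _ ↦ zero_le) fun n ↦
        enorm_iteratedFDeriv_le_supCkENorm (Nat.zero_le m) (hmem n) _)
  have h2 := ((continuous_eval_const (fun _ : Fin 0 ↦ (0 : E4))).tendsto _).comp h1
  simp only [Function.comp_def, iteratedFDeriv_zero_apply, zero_apply] at h2
  exact h2

/-- **Dark limits of an asymptotically stationary hole chart are stationary.** Let `Ψ` be a smooth
hole chart on `boostedKerrBackground Λ c M a` satisfying the era's asymptotic-stationarity clause (the
`Cᵐ` sup norm over every truncated slab `{t* = τ, r ≤ R'}` of `∂_{Λe₀}` of its deviation tends to `0`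
as `τ → ∞`), and let `g` be a `Cᵏ` (`k ≥ 1`) ω-limit of the deviation translates along chart times
`T n → +∞`, in `Cᵏ` on compact subsets of the exterior (as produced by `exists_omegaLimit_hole_translate`
/ `exists_strictMono_forall_omegaLimit_translate`). Then `g (x + s • Λe₀) = g x` on the whole boosted
exterior. Hale 1980, Ch. X, §1. [cite: Hale1980, Ch. X §1] -/
theorem hole_omegaLimit_translate_eq_self_of_asymptoticallyStationary
    {Ψ : (boostedKerrBackground Λ c M a).domain → 𝓢.carrier} (hΨ : ContMDiff 𝓘(ℝ, E4) (𝓡 4) ∞ Ψ) {m : ℕ}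
    (hstat : ∀ R' : ℝ, Tendsto (fun τ ↦ supCkENorm
        (Subtype.val '' (boostedKerrBackground Λ c M a).truncTimeSlab R' τ) m
        (fun y ↦ fderiv ℝ (𝓢.deviationExtend (boostedKerrBackground Λ c M a) Ψ) y
          ((Λ : E4 ≃L[ℝ] E4) (E4.basisVector 0)))) atTop (𝓝 0))
    {k : ℕ} (hk : 1 ≤ k) {g : E4 → E4 →L[ℝ] E4 →L[ℝ] ℝ}
    (hg : ContDiffOn ℝ k g (boostedKerrExterior Λ c M a : Set E4)) {T : ℕ → ℝ} (hT : Tendsto T atTop atTop)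
    (hlim : ∀ K ⊆ (boostedKerrExterior Λ c M a : Set E4), IsCompact K →
      Tendsto (fun n ↦ supCkENorm K k (fun x ↦
        𝓢.deviationExtend (boostedKerrBackground Λ c M a) Ψ
          (x + T n • (Λ : E4 ≃L[ℝ] E4) (E4.basisVector 0)) - g x)) atTop (𝓝 0)) :
    ∀ x ∈ (boostedKerrExterior Λ c M a : Set E4), ∀ s : ℝ,
      g (x + s • (Λ : E4 ≃L[ℝ] E4) (E4.basisVector 0)) = g x :=
  omegaLimit_translate_eq_self_of_tendsto_fderiv_apply (boostedKerrExterior Λ c M a).isOpen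
    (add_smul_mem_boostedKerrBackground_domain Λ c M a) hk
    ((contDiffOn_deviationExtend_boostedKerr 𝓢 hΨ).of_le (by exact_mod_cast le_top)) hg hlim
    fun _ hx ↦ tendsto_fderiv_deviationExtend_translate_of_asymptoticallyStationary 𝓢 Λ c M a Ψ hstat hT hx

/-- **The limit chart metric of an asymptotically stationary hole chart is stationary**: under the
hypotheses of `hole_omegaLimit_translate_eq_self_of_asymptoticallyStationary`, the limit chart metric
`G = g + g_{M,a,Λ,c}` satisfies `G (x + s • Λe₀) = G x` on the boosted exterior — verbatim the
stationarity hypothesis of the no-hair statement granted to `stub_rebase` (the boosted Kerr–Schild form is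
itself orbit-invariant, `KerrSchildChart.boostedKerrBilin_add_smul`). [cite: Hale1980, Ch. X §1] -/
theorem hole_omegaLimit_chartMetric_translate_eq_self_of_asymptoticallyStationary :
  ∀ (𝓢 : Spacetime.{0} 4) (Λ : lorentzGroup) (c : E4) (M a : ℝ) (Ψ : (boostedKerrBackground Λ c M a).domain → 𝓢.carrier), ContMDiff 𝓘(ℝ, E4) (𝓡 4) ∞ Ψ → ∀ (m : ℕ), (∀ R' : ℝ, Tendsto (fun τ ↦ supCkENorm (Subtype.val '' (boostedKerrBackground Λ c M a).truncTimeSlab R' τ) m (fun y ↦ fderiv ℝ (𝓢.deviationExtend (boostedKerrBackground Λ c M a) Ψ) y ((Λ : E4 ≃L[ℝ] E4) (E4.basisVector 0)))) atTop (𝓝 0)) → ∀ (k : ℕ), 1 ≤ k → ∀ (g : E4 → E4 →L[ℝ] E4 →L[ℝ] ℝ), ContDiffOn ℝ k g (boostedKerrExterior Λ c M a : Set E4) → ∀ (T : ℕ → ℝ), Tendsto T atTop atTop → (∀ K ⊆ (boostedKerrExterior Λ c M a : Set E4), IsCompact K → Tendsto (fun n ↦ supCkENorm K k (fun x ↦ 𝓢.deviationExtend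 (boostedKerrBackground Λ c M a) Ψ (x + T n • (Λ : E4 ≃L[ℝ] E4) (E4.basisVector 0)) - g x)) atTop (𝓝 0)) → ∀ x ∈ (boostedKerrExterior Λ c M a : Set E4), ∀ s : ℝ, g (x + s • (Λ : E4 ≃L[ℝ] E4) (E4.basisVector 0)) + boostedKerrBilin Λ c M a (x + s • (Λ : E4 ≃L[ℝ] E4) (E4.basisVector 0)) = g x + boostedKerrBilin Λ c M a x := by
  intro 𝓢 Λ c M a Ψ hΨ m hstat k hk g hg T hT hlim x hx s
  rw [hole_omegaLimit_translate_eq_self_of_asymptoticallyStationary 𝓢 Λ c M a hΨ hstat hk hg hT hlim x hx s]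
  exact congrArg _ (KerrSchildChart.boostedKerrBilin_add_smul Λ c M a x s)

end Hole

end Summit.FinalStateConjecture.FinalStateConjecture.Theorems.ClusterCompleteness

end
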